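import Literature.AnabelianGeometry.EtaleTheta.SettingModelAbelianShadow
import Literature.AnabelianGeometry.EtaleTheta.SettingModel

/-!
# A model of the [EtTh] §1 root, part H: the compactness binder `hΔ : IsCompact Δ_Θ`
# (GAP-LEDGER G-w5d187-1) is NOT a consequence of the root interface — the model's `Δ_Θ` is an
# infinite subgroup of a DISCRETE `(Π^tp_X)^Θ`

Mochizuki, *The étale theta function and its Frobenioid-theoretic manifestations*, Publ. RIMS **45**
(2009) [EtTh], §1, PRIMS PDF p. 12 [cite: MochizukiEtTh2009, §1 p.12]: "a natural exact sequence of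
abelian profinite groups `1 → Δ_Θ → (Δ^tp_Y)^Θ → (Δ^tp_Y)^ell → 1`", "`(Ẑ(1) ≅) Δ_Θ`".  Layer L2 / L6
of the abc-iut cell (seat abc-iut-w5-d028, proof-only sequel of abc-iut-L2-t1's model files A–E and of
part G `SettingModelIndependence.lean`, p421746).

In the cell the sentence "`Δ_Θ` is profinite inside the Hausdorff group `(Π^tp_X)^Θ`" is carried by the
consumers of [IUTchII] Prop. 2.2 (ii) (sub-DAG row Prop-22.ii.r13a: `exists_root_lDeltaTheta`,
`toLim_nsmul_of_torsion`, `inftyClause_of_cyclotomeTower_of_prop15iii`, `exists_forall_modAll_red_eq`, …)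
as the explicit binder `hΔ : IsCompact (D.DeltaTheta : Set D.GtpTheta)` (often together with
`[T2Space D.GtpTheta]`), recorded in `plan/GAP-LEDGER.md` as row **G-w5d187-1** with proposed disposition
"root-axiom FIELD on `ThetaSetting`".  THIS FILE gives the kernel-checked numbers behind that disposition:

* `mk_commutator_mem_deltaTheta` — the class of `(⁅a,b⁆, 1) ∈ Π^tp_X = F₂ × Γ` lies in the model's `Δ_Θ`
  (`[F₂,F₂] × 1 ⊆ toHat⁻¹([Δ_X,Δ_X]⁻)`, part B);
* `eq_of_mk_commutator_pow_eq` — its powers are pairwise distinct in `(Π^tp_X)^Θ`: a relation would put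
  `(⁅a,b⁆, 1)^(m-n)` in `toHat⁻¹([[Δ_X,Δ_X],Δ_X]⁻)`, which dies in the discrete Heisenberg group (part D's
  class-2 shadow `heisHom_eq_one_and_snd_eq_one_of_mem_KTheta`), whereas `⁅a,b⁆ ↦ (0,0,1)` has infinite
  order there; hence `infinite_deltaTheta`;
* `discreteTopology_gtpTheta_model`, `t2Space_gtpTheta_model` — the model's `(Π^tp_X)^Θ` is discrete
  (quotient of the discrete `Π^tp_X` by an open subgroup), in particular Hausdorff;
* `not_isCompact_deltaTheta_model` — so `Δ_Θ(model)`, infinite and discrete, is NOT compact;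
* `hDelta_not_derivable : ¬ ∀ D : ThetaSetting p, D.IsEtThOrigin → IsCompact (D.DeltaTheta : Set D.GtpTheta)`
  — the binder `hΔ` is independent of the root interface `ThetaSetting p` plus its guard `IsEtThOrigin`
  (the model satisfies both, `ThetaSetting.model_isEtThOrigin`), while its companion `[T2Space D.GtpTheta]`
  HOLDS at the model: the pair requested by G-w5d187-1 fails exactly at compactness.

CONSEQUENCE FOR THE PLANNERS (numbers, not opinions): `hΔ` can never be discharged as a lemma over
Setting v3; it must stay an explicit binder or become a root field — and a root field `isCompact_deltaTheta`
would EXCLUDE `ThetaSetting.model p`, at present the only kernel inhabitant of the L2 root, so the cell's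
non-vacuity witness for `∀ D : ThetaSetting p, D.IsEtThOrigin → …` statements would have to be rebuilt on a
model with profinite `Δ_Θ` (cf. part G: the same model already violates `hYcl`, G-w4d021-2).
Proof-only: no definitions, no instances, no Prop facts; nothing of [EtTh] is asserted; no side is taken on
[IUTchIII] Cor. 3.12.
-/

noncomputable section

namespace Literature.AnabelianGeometry.EtaleTheta.SettingModel

open scoped commutatorElement

variable (p : ℕ) [Fact p.Prime]

/-! ### An element of infinite order in the model's `Δ_Θ` -/

/-- The class in `(Π^tp_X)^Θ` of `(⁅a,b⁆, 1) ∈ Π^tp_X = F₂ × Γ` lies in the model's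
`Δ_Θ = Ker((Π^tp_X)^Θ ↠ (Π^tp_X)^ell)`, since `[F₂,F₂] × 1 ⊆ toHat⁻¹([Δ_X,Δ_X]⁻)` (part B,
`mem_KEll_of_mem_commutator`). [cite: MochizukiEtTh2009, §1 p.12] -/
theorem mk_commutator_mem_deltaTheta :
    ((((Del.ofF₂ ⁅FreeGroup.of (0 : Fin 2), FreeGroup.of 1⁆, 1) : PiTp p)) : GTheta p) ∈
      (ThetaSetting.model p).DeltaTheta := by
  refine (mk_mem_ker_thetaToEllM_iff p _).mpr (mem_KEll_of_mem_commutator p rfl ?_)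
  show ⁅FreeGroup.of (0 : Fin 2), FreeGroup.of 1⁆ ∈ commutator F₂
  rw [commutator_def]
  exact Subgroup.commutator_mem_commutator (Subgroup.mem_top _) (Subgroup.mem_top _)

/-- The powers of the class of `(⁅a,b⁆, 1)` in `(Π^tp_X)^Θ` are pairwise distinct: a coincidence
`c^n = c^m` puts `(⁅a,b⁆,1)^{-n}·(⁅a,b⁆,1)^{m}` in `Ker(Π^tp_X ↠ (Π^tp_X)^Θ) = toHat⁻¹([[Δ_X,Δ_X],Δ_X]⁻)`,
which dies in the discrete Heisenberg group `Heis ℤ` (part D, `heisHom_eq_one_and_snd_eq_one_of_mem_KTheta`),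
whereas `⁅a,b⁆ ↦ (0,0,1)` (`heisHom_commutator`) has `(1,3)`-entry of `c^{m-n}` equal to `m - n`.
[cite: MochizukiEtTh2009, §1 p.12] -/
theorem eq_of_mk_commutator_pow_eq {n m : ℕ}
    (h : ((((Del.ofF₂ ⁅FreeGroup.of (0 : Fin 2), FreeGroup.of 1⁆, 1) : PiTp p) ^ n : PiTp p) : GTheta p) =
      ((((Del.ofF₂ ⁅FreeGroup.of (0 : Fin 2), FreeGroup.of 1⁆, 1) : PiTp p) ^ m : PiTp p) : GTheta p)) :
    n = m := by
  rw [QuotientGroup.eq] at h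
  have h1 := (heisHom_eq_one_and_snd_eq_one_of_mem_KTheta p h).1
  simp only [Prod.fst_mul, Prod.fst_inv, Prod.pow_fst, map_mul, map_inv, map_pow, Del.val_ofF₂,
    heisHom_commutator] at h1
  rw [← zpow_natCast, ← zpow_natCast, Heis.zpow_eq_of_mul_eq_zero _ (by simp),
    Heis.zpow_eq_of_mul_eq_zero _ (by simp)] at h1
  have hz := congrArg Heis.z h1
  simp only [Heis.mul_z, Heis.inv_z, Heis.inv_x, Heis.one_z, mul_zero, mul_one, neg_zero,
    add_zero] at hz
  omega

/-- **The model's `Δ_Θ` is infinite** (it contains the infinite cyclic group generated by the class of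
`(⁅a,b⁆, 1)` — the centre of the discrete Heisenberg group). [cite: MochizukiEtTh2009, §1 p.12] -/
theorem infinite_deltaTheta : Infinite (ThetaSetting.model p).DeltaTheta := by
  refine Infinite.of_injective
    (fun n : ℕ => (⟨((((Del.ofF₂ ⁅FreeGroup.of (0 : Fin 2), FreeGroup.of 1⁆, 1) : PiTp p)) : GTheta p) ^ n,
      Subgroup.pow_mem _ (mk_commutator_mem_deltaTheta p) n⟩ : (ThetaSetting.model p).DeltaTheta))
    fun n m hnm => ?_
  have h := congrArg Subtype.val hnm
  dsimp only at h
  rw [← QuotientGroup.mk_pow, ← QuotientGroup.mk_pow] at h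
  exact eq_of_mk_commutator_pow_eq p h

/-! ### The model's `(Π^tp_X)^Θ` is discrete; `Δ_Θ(model)` is not compact -/

/-- The model's `(Π^tp_X)^Θ = Π^tp_X / toHat⁻¹([[Δ_X,Δ_X],Δ_X]⁻)` is DISCRETE (quotient of the discrete
`Π^tp_X = F₂ × Γ` by an open subgroup). [cite: MochizukiEtTh2009, §1 p.12] -/
theorem discreteTopology_gtpTheta_model : DiscreteTopology (ThetaSetting.model p).GtpTheta :=
  QuotientGroup.discreteTopology (isOpen_discrete _)

/-- Hence the model's `(Π^tp_X)^Θ` is Hausdorff: the companion binder `[T2Space D.GtpTheta]` of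
G-w5d187-1 HOLDS at the model. [cite: MochizukiEtTh2009, §1 p.12] -/
theorem t2Space_gtpTheta_model : T2Space (ThetaSetting.model p).GtpTheta := by
  haveI := discreteTopology_gtpTheta_model p
  infer_instance

/-- **The compactness binder `hΔ` FAILS in the model**: `Δ_Θ(model)` is an infinite subset of a
discrete space, so it is not compact. [cite: MochizukiEtTh2009, §1 p.12] -/
theorem not_isCompact_deltaTheta_model :
    ¬ IsCompact ((ThetaSetting.model p).DeltaTheta : Set (ThetaSetting.model p).GtpTheta) := by
  intro hK
  haveI := discreteTopology_gtpTheta_model p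
  haveI := infinite_deltaTheta p
  exact (hK.finite_of_discrete).not_infinite
    (Set.infinite_coe_iff.mp (show Infinite (ThetaSetting.model p).DeltaTheta from inferInstance))

/-- **`hΔ` is not derivable from the root interface and its guard**: the GAP-LEDGER binder
G-w5d187-1 ("`Δ_Θ` is compact in `(Π^tp_X)^Θ`") is independent of `ThetaSetting p` + `IsEtThOrigin` —
the model satisfies both (`ThetaSetting.model_isEtThOrigin`) and violates `hΔ`.  A kernel-checked answer
for the planners: the sentence must stay a binder or become a root field (which would exclude the present
model). [cite: MochizukiEtTh2009, §1 p.12] -/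
theorem hDelta_not_derivable :
    ¬ ∀ D : ThetaSetting p, D.IsEtThOrigin → IsCompact (D.DeltaTheta : Set D.GtpTheta) :=
  fun h => not_isCompact_deltaTheta_model p (h _ (ThetaSetting.model_isEtThOrigin p))

/-- The same with the Hausdorff companion made explicit: even `IsEtThOrigin ∧ T2Space (Π^tp_X)^Θ` does not
give `hΔ` (both hold at the model). [cite: MochizukiEtTh2009, §1 p.12] -/
theorem hDelta_not_derivable_of_t2 :
    ¬ ∀ D : ThetaSetting p, D.IsEtThOrigin → T2Space D.GtpTheta →
        IsCompact (D.DeltaTheta : Set D.GtpTheta) :=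
  fun h => not_isCompact_deltaTheta_model p
    (h _ (ThetaSetting.model_isEtThOrigin p) (t2Space_gtpTheta_model p))

end Literature.AnabelianGeometry.EtaleTheta.SettingModel

end
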